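import Mathlib
import Summits.NavierStokesRegularity.NavierStokesRegularity.Theorems.WakeRatchetTailRatchetDyadicBlowup
import HarnessLib

/-!
# `WakeRatchet.TailRatchet` (stmt-NavierStokesRegularity-21808), door D4′ — Cauchy side:
# RECENTRED FRAMES of a physical dyadic solution solve the renormalised lattice; frames of the blow-up
# solution are uniformly bounded on growing half-lines

Def-free.  MODEL lattice ODEs only (the scalar dyadic chain of Tao 2016 §1.2 / §4 and its renormalised
form of §6.4); nothing in this file is a statement about the Navier–Stokes equations; stmt-21808 is neither
proved nor refuted here and no stub of skeleton d00b85951d7c is closed.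

WHY.  The scalar extraction `WakeRatchetDyadicScalarEternal.tailRatchet_false_of_scalarFrames` consumes
scalar FRAMES `V_j n σ` solving the renormalised dyadic lattice `V' = −V + ΛV²₋ − Λ⁻¹VV₊` on half-lines
`σ > A_j`, uniformly bounded.  The Cauchy side produces a PHYSICAL solution `Ẋₙ = Λⁿ⁻¹Xₙ₋₁² − ΛⁿXₙXₙ₊₁`
blowing up at `T*` (`WakeRatchetDyadicCauchy.dyadic_blowup`).  This file is the dictionary between
the two:

* `hasDerivAt_scalarFrame` — for ANY solution `X` of the physical lattice on `(a, T)` and any recentring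
  (shell shift `m`, log-time shift `s`), the frame `V n σ = Λⁿ⁺ᵐ e^{−(σ+s)} X_{n+m}(T − e^{−(σ+s)})`
  solves the renormalised lattice at every `σ` with `T − e^{−(σ+s)} ∈ (a, T)` (chain rule).
* `blowup_frames_bounded` — along the maximal non-negative blow-up solution of `dyadic_blowup_typeI`
  (blow-up time `T*`), every family of frames recentred at shells `m_j` and log-times `s_j` solves the
  renormalised lattice and obeys `0 ≤ V_j n σ ≤ 2Λ²/(Λ−1)²` on the half-line `σ > −s_j − log T*`; if
  `s_j → +∞` these half-lines exhaust `ℝ`.  These are the «law» and «uniform bound» hypotheses of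
  `tailRatchet_false_of_scalarFrames`; the remaining ones (window mass = (Q)+(D), per-shell forward energy
  bound, persistent firing at fixed recentred log-times) are the analytic debt of door D4′.

HONEST FRAMING: chain-rule bookkeeping; (Q), (D) and the firing clock are NOT addressed; rung 0.
-/

noncomputable section

set_option linter.dupNamespace false

namespace Summit.NavierStokesRegularity.NavierStokesRegularity.Theorems

namespace WakeRatchetDyadicCauchy

open Set Filter Topology

/-! ## Frames of a physical solution solve the renormalised lattice -/

/-- **Recentred frames solve the renormalised lattice.**  Let `Λ > 0` and let `X` solve
`Ẋₙ = Λⁿ⁻¹Xₙ₋₁² − ΛⁿXₙXₙ₊₁` on `(a, T)` at every shell.  For a shell shift `m` and a log-time shift `s`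
put `V n σ = Λⁿ⁺ᵐ · e^{−(σ+s)} · X_{n+m}(T − e^{−(σ+s)})`.  Then at every `σ` with
`T − e^{−(σ+s)} ∈ (a, T)`:  `V_n' = −V_n + Λ V_{n−1}² − Λ⁻¹ V_n V_{n+1}`.
[cite: Tao2016AveragedNS, §1.2 (dyadic model), §4 Lemma 4.1 (4.8), §6.4 (self-similar variables `t* − t = e^{−σ}`, `X_n = Λ^{-n}e^{σ}W_n`); elementary (chain rule)] -/
theorem hasDerivAt_scalarFrame {Λ a T : ℝ} (hΛ : 0 < Λ) {X : ℤ → ℝ → ℝ}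
    (hlaw : ∀ n : ℤ, ∀ t ∈ Ioo a T,
      HasDerivAt (X n) (Λ ^ (n - 1) * X (n - 1) t ^ 2 - Λ ^ n * X n t * X (n + 1) t) t)
    (m : ℤ) (s : ℝ) (n : ℤ) {σ : ℝ} (hσ : T - Real.exp (-(σ + s)) ∈ Ioo a T) :
    HasDerivAt (fun σ => Λ ^ (n + m) * Real.exp (-(σ + s)) * X (n + m) (T - Real.exp (-(σ + s))))
      (-(Λ ^ (n + m) * Real.exp (-(σ + s)) * X (n + m) (T - Real.exp (-(σ + s))))
        + Λ * (Λ ^ (n - 1 + m) * Real.exp (-(σ + s)) * X (n - 1 + m) (T - Real.exp (-(σ + s)))) ^ 2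
        - Λ⁻¹ * (Λ ^ (n + m) * Real.exp (-(σ + s)) * X (n + m) (T - Real.exp (-(σ + s))))
          * (Λ ^ (n + 1 + m) * Real.exp (-(σ + s)) * X (n + 1 + m) (T - Real.exp (-(σ + s))))) σ := by
  have hΛne : Λ ≠ 0 := hΛ.ne'
  set k : ℤ := n + m with hk
  set ρ : ℝ → ℝ := fun σ => Real.exp (-(σ + s)) with hρ
  set τ : ℝ → ℝ := fun σ => T - Real.exp (-(σ + s)) with hτ
  -- derivatives of the clock
  have hρd : HasDerivAt ρ (-(ρ σ)) σ := by
    have h1 : HasDerivAt (fun σ : ℝ => -(σ + s)) (-1) σ :=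
      (((hasDerivAt_id σ).add_const s).neg).congr_of_eventuallyEq
        (Eventually.of_forall fun x => rfl)
    have h2 := (Real.hasDerivAt_exp (-(σ + s))).comp σ h1
    refine h2.congr_deriv ?_
    simp [hρ]
  have hτd : HasDerivAt τ (ρ σ) σ := by
    have := (hasDerivAt_const σ T).sub hρd
    refine this.congr_deriv ?_
    ring
  -- the physical law at the image time, composed with the clock
  have hX : HasDerivAt (fun σ => X k (τ σ))
      ((Λ ^ (k - 1) * X (k - 1) (τ σ) ^ 2 - Λ ^ k * X k (τ σ) * X (k + 1) (τ σ)) * ρ σ) σ :=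
    (hlaw k (τ σ) hσ).comp σ hτd
  have hprod := (hρd.mul hX).const_mul (Λ ^ k)
  -- exponent bookkeeping
  have e1 : n - 1 + m = k - 1 := by rw [hk]; ring
  have e2 : n + 1 + m = k + 1 := by rw [hk]; ring
  rw [e1, e2]
  have hfun : (fun σ => Λ ^ k * Real.exp (-(σ + s)) * X k (T - Real.exp (-(σ + s))))
      = fun σ => Λ ^ k * (ρ σ * X k (τ σ)) := by
    funext σ'; simp only [hρ, hτ]; ring
  rw [hfun]
  refine hprod.congr_deriv ?_
  simp only [hρ, hτ]
  rw [zpow_sub_one₀ hΛne, zpow_add_one₀ hΛne]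
  field_simp
  ring

/-! ## Frames of the non-negative blow-up solution are uniformly bounded on growing half-lines -/

/-- **FRAMES OF THE DYADIC BLOW-UP: law and uniform bound.**  Let `Λ > 1` and take a non-negative datum in
`ℓ^∞_Λ` with a positive shell.  There are `T* > 0` and a solution `X` of the physical lattice through the
datum (the maximal regular solution of `dyadic_blowup`, blowing up at `T*`) such that for EVERY
recentring (shell shifts `m_j : ℤ`, log-time shifts `s_j : ℝ`) the frames
`V_j n σ = Λⁿ⁺ᵐʲ e^{−(σ+s_j)} X_{n+m_j}(T* − e^{−(σ+s_j)})` solve the renormalised lattice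
`V' = −V + ΛV²₋ − Λ⁻¹VV₊` and satisfy `0 ≤ V_j n σ ≤ 2Λ²/(Λ−1)²` on the half-line `σ > −s_j − log T*`.
(With `s_j → +∞` the half-lines exhaust `ℝ`: the «law» and «uniform bound» inputs of
`WakeRatchetDyadicScalarEternal.tailRatchet_false_of_scalarFrames`.)
[cite: Tao2016AveragedNS, §1.2, §4 Lemma 4.1 (4.8), §6.4; elementary] -/
theorem blowup_frames_bounded {Λ R : ℝ} (hΛ : 1 < Λ) (hR : 0 ≤ R) {X₀ : ℤ → ℝ}
    (hX₀ : ∀ n : ℤ, |Λ ^ n * X₀ n| ≤ R) (hpos : ∀ n : ℤ, 0 ≤ X₀ n) {M : ℤ} (hM : 0 < X₀ M) :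
    ∃ Tstar : ℝ, 0 < Tstar ∧ ∃ X : ℤ → ℝ → ℝ, (∀ n : ℤ, X n 0 = X₀ n) ∧
      (∀ B : ℝ, ∃ n : ℤ, ∃ t ∈ Ico 0 Tstar, B < Λ ^ n * X n t) ∧
      ∀ (m : ℕ → ℤ) (s : ℕ → ℝ) (j : ℕ) (n : ℤ) (σ : ℝ), -(s j) - Real.log Tstar < σ →
        HasDerivAt (fun σ => Λ ^ (n + m j) * Real.exp (-(σ + s j))
            * X (n + m j) (Tstar - Real.exp (-(σ + s j))))
          (-(Λ ^ (n + m j) * Real.exp (-(σ + s j)) * X (n + m j) (Tstar - Real.exp (-(σ + s j))))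
            + Λ * (Λ ^ (n - 1 + m j) * Real.exp (-(σ + s j))
                * X (n - 1 + m j) (Tstar - Real.exp (-(σ + s j)))) ^ 2
            - Λ⁻¹ * (Λ ^ (n + m j) * Real.exp (-(σ + s j)) * X (n + m j) (Tstar - Real.exp (-(σ + s j))))
              * (Λ ^ (n + 1 + m j) * Real.exp (-(σ + s j))
                * X (n + 1 + m j) (Tstar - Real.exp (-(σ + s j))))) σ ∧
        0 ≤ Λ ^ (n + m j) * Real.exp (-(σ + s j)) * X (n + m j) (Tstar - Real.exp (-(σ + s j))) ∧
        Λ ^ (n + m j) * Real.exp (-(σ + s j)) * X (n + m j) (Tstar - Real.exp (-(σ + s j)))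
          ≤ 2 * Λ ^ 2 / (Λ - 1) ^ 2 := by
  have hΛ0 : 0 < Λ := by linarith
  obtain ⟨Tstar, hδT, _, X, h0, hlaw, _, hnonneg, hupper, hunb⟩ :=
    dyadic_blowup hΛ hR hX₀ hpos hM
  have hδ : 0 < 1 / ((Λ + Λ⁻¹) * (R + 1) ^ 2 + 1) := by
    have : 0 < Λ⁻¹ := inv_pos.2 hΛ0
    positivity
  have hT : 0 < Tstar := hδ.trans_le hδT
  refine ⟨Tstar, hT, X, h0, hunb, fun m s j n σ hσ => ?_⟩
  -- the image time lies in `[0, T*)`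
  have hexp : Real.exp (-(σ + s j)) < Tstar := by
    have h1 : -(σ + s j) < Real.log Tstar := by linarith
    calc Real.exp (-(σ + s j)) < Real.exp (Real.log Tstar) := Real.exp_lt_exp.2 h1
      _ = Tstar := Real.exp_log hT
  have hτ0 : 0 ≤ Tstar - Real.exp (-(σ + s j)) := by linarith
  have hτT : Tstar - Real.exp (-(σ + s j)) < Tstar := by
    have := Real.exp_pos (-(σ + s j)); linarith
  have hτ : Tstar - Real.exp (-(σ + s j)) ∈ Ioo (-(1 / ((Λ + Λ⁻¹) * (R + 1) ^ 2 + 1))) Tstar :=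
    ⟨by linarith, hτT⟩
  have hτ' : Tstar - Real.exp (-(σ + s j)) ∈ Ico 0 Tstar := ⟨hτ0, hτT⟩
  refine ⟨hasDerivAt_scalarFrame hΛ0 hlaw (m j) (s j) n hτ, ?_, ?_⟩
  · exact mul_nonneg (mul_nonneg (zpow_pos hΛ0 _).le (Real.exp_pos _).le) (hnonneg _ _ hτ')
  · have h := hupper (n + m j) _ hτ'
    -- `T* − τ = e^{−(σ+s)}`
    have hid : Tstar - (Tstar - Real.exp (-(σ + s j))) = Real.exp (-(σ + s j)) := by ring
    rw [hid] at h
    calc Λ ^ (n + m j) * Real.exp (-(σ + s j)) * X (n + m j) (Tstar - Real.exp (-(σ + s j)))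
        = Λ ^ (n + m j) * X (n + m j) (Tstar - Real.exp (-(σ + s j))) * Real.exp (-(σ + s j)) := by
          ring
      _ ≤ 2 * Λ ^ 2 / (Λ - 1) ^ 2 := h

end WakeRatchetDyadicCauchy

end Summit.NavierStokesRegularity.NavierStokesRegularity.Theorems

end
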